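import Mathlib
import Summits.ValiantsHypothesis.ValiantsHypothesis.Theses.LacunarySymmetroid
import Summits.ValiantsHypothesis.ValiantsHypothesis.Theorems.LacunarySymmetroidMatrixDescartesCensusDefs
import Summits.ValiantsHypothesis.ValiantsHypothesis.Theorems.LacunarySymmetroidMatrixDescartesCensusCertificates
import Summits.ValiantsHypothesis.ValiantsHypothesis.Theorems.LacunarySymmetroidMatrixDescartesDegreeCeiling
import Summits.ValiantsHypothesis.ValiantsHypothesis.Theorems.LacunarySymmetroidMatrixDescartesStubDescartesCeiling
import Summits.ValiantsHypothesis.ValiantsHypothesis.Theorems.LacunarySymmetroidMatrixDescartesCensusTable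
import Summits.ValiantsHypothesis.ValiantsHypothesis.Theorems.MatrixDescartes.Negative.MatrixDescartesHypRootLawAtTwoFour
import Summits.ValiantsHypothesis.ValiantsHypothesis.Theorems.LacunarySymmetroidMatrixDescartesFiniteSectorRealisable
import Summits.ValiantsHypothesis.ValiantsHypothesis.Theorems.LacunarySymmetroidMatrixDescartesFiniteSectorRealisableThreeFour
import Literature.Computability.AlgebraicComplexity.RealTauKnownCases

/-!
# `MatrixDescartes` — line «finite» (val-idea-6 g3, lens = reduction-to-finite): THEOREM FIRST — the
# certificate ⇒ sector lemma, the DOUBLING lemma and the POSTAGE-STAMP ceiling; COMPUTATION SECOND — the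
# located sector table `η(m,K)` and the finite search spec handed to the desk's engines

HONEST FRAMING.  Crux `Summit.ValiantsHypothesis.ValiantsHypothesis.Theses.LacunarySymmetroid.MatrixDescartes`
(stmt-ValiantsHypothesis-18050), asymptotic in `K`; this workfile proves NOTHING toward it and nothing about
`VP ≠ VNP`.  It serves the INSTRUMENT of the g2 door «hyperbolic» (`Cruxes/MatrixDescartes/Lines/hyperbolic.lean`:
the real-rooted-simple SECTOR `IsRealRootedSimple p : #distinct real roots = natDegree`, sector row
`HypRootLawAt m K B` «`η(m,K) ≤ B`», crux H3 `HyperbolicLaw` = `q = 2` MDR in the sector), namely the critics'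
replacement instrument (val-idea-crit-2, bus l.9665; director-valiant b54): SECTOR-FULLNESS at the fat cells —
«an in-sector pencil of degree 18 at `(2,5)` / degree 13 at `(3,3)`».  The reduction-to-finite is:

* **T1 (certificate ⇒ sector, PROVED, by name from the tree).**  `natDegree_eq_and_card_eq_of_alternating`:
  exponents `≤ D` (tree `DegreeCeiling.natDegree_det_pencil_le`: `deg ≤ m·D`) and `m·D + 1` strictly increasing
  reals with alternating determinant signs (tree `Census.le_card_roots_pencil_of_alternating`: `Z ≥ m·D`) force
  `deg = Z = m·D`: the pencil is IN the sector, of known degree.  So ONE rational certificate decides a sector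
  cell from below (`not_hypRootLawAt_of_alternating`), exactly as census rows are decided.
* **T2 (DOUBLING, PROVED).**  `det (∑ X^(2 d l) • S l) = expand 2 (det (∑ X^(d l) • S l))` (`det_pencil_double`);
  if the half-pencil determinant `q` is FULL-POSITIVE-ROOTED (`IsFullPosRooted q : #distinct positive roots =
  natDegree`) then `q(X²)` is in the sector with twice the degree (`isRealRootedSimple_double`), so
  `ν(m,K) ≥ n ⇒ η(m,K) ≥ 2n` (`not_hypRootLawAt_of_fullPos`), where `ν(m,K)` («`StampLawAt m K B`» ⇔ `ν ≤ B`) is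
  the largest degree of a full-positive-rooted symmetric `(m,K)` half-pencil.  (The census identity
  `M = 2ζ + 1`, tree `posRootLawAt_iff_realRootLawAt`, is the same substitution plus a root at `0`; in the sector
  the extra root at `0` is unavailable for `m ≥ 2` and FULL positive-rootedness is required.)
* **T3 (POSTAGE-STAMP CEILING, PROVED).**  Full positive-rootedness forces EVERY coefficient `0 … n` to be
  non-zero (Descartes: `n ≤ V(q) < #support`, Mathlib `roots_countP_pos_le_signVariations` + Literature
  `signVariations_lt_card_support`), and `supp det ⊆ m`-fold sumset of the exponents (tree
  `StubDescartesCeiling.support_det_pencil_subset`); hence `[0, n] ⊆ m·E` (`mem_sumset_of_fullPos`):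
  **`ν(m,K) ≤ n(m, K−1)`, the classical POSTAGE-STAMP NUMBER** (`m` stamps, `K−1` denominations; Rohrbach /
  Stöhr / Alter–Barnett / Challis–Robinson / Mossige / Selmer tables: `n(2,k) = 4,8,12,16,20,26,…`,
  `n(3,k) = 7,15,24,36,…`, `n(h,2) = ⌊(h²+6h+1)/4⌋`).
* **GAP RULE (classical, REGISTERED STUB `stub_gapRule`)** — a real-rooted polynomial has no two consecutive
  vanishing coefficients inside its support (Pólya–Szegő, Obreschkoff): in the sector `supp det` is a chain with
  steps `≤ 2` from `{0,1}` inside `m·E`, so `η(m,K) ≤ σ(m,K)` := the largest such chain top over `K`-element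
  supports — a finite, computed quantity (`instr/stamp.py`, `instr/sieve_wide*.out`): `σ(2,3..7) = 8,16,24,32,40`,
  `σ(3,3..5) = 14,30,48`, `σ(4,3..4) = 20,52`, `σ(5,3..4) = 28,70`, `σ(6,3) = 36`, and at all thirteen cells
  enumerated (certified exactly: `dmax ≥ σ + 2`) **`σ(m,K) = 2·n(m,K−1)`** (conjecture Σ: the mixed-parity chains never beat doubling; ties occur, e.g.
  `(0,2,6,8,17,20,30)` at `(2,7)`).

LOCATED SECTOR TABLE (kernel certificates below + engine-5 support tables; `M = 2ζ+1` from the tree's census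
table; `M_loc` = crit-2's located non-reflected maxima):
  `(2,3)`: `η = 8 = σ` (dense diagonal) · `M = 11` ·
  `(2,4)`: **`η = 16 = σ`** (`not_hypRootLawAt_two_four_15`, doubled `(0,1,3,4)`; was `≥ 14`) · `M = 19`, `M_loc = 14` ·
  `(2,5)`: **`η = 24 = σ`** (`not_hypRootLawAt_two_five_23`, doubled extremal stamp basis `(0,1,3,5,6)`) · `M = 29`,
           `M_loc = 18` — the director's «degree-18 in-sector pencil at (2,5)» EXISTS (degree 24, 24 real simple roots);
  `(2,6)`: **`28 ≤ η ≤ 32 = σ`** (`not_hypRootLawAt_two_six_27`, doubled `(0,1,2,5,6,7)`; open: realise the unique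
           extremal basis `(0,1,3,5,7,8)` with 16 positive roots) · `M ≥ 2·18+1`, `M_loc = 22` ·
  `(3,3)`: `12 ≤ η ≤ 14 = σ`; **degree 13 is IMPOSSIBLE** (no 3-set has an odd chain top ≥ 13; `σ` is attained only
           on `(0,2,6)`): `η(3,3) = 14` iff `(0,1,3)` carries a full-positive-rooted half-pencil of degree `7 = n(3,2)`
           (forces `det S₂ = 0`) · `M = 19`, `M_loc = 13` ·
  `(3,4)`: **`24 ≤ η ≤ 30 = σ < 34 = M_loc < 37 ≤ M`** (`not_hypRootLawAt_three_four_23`, doubled `(0,1,3,4)`; open: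
           `15` positive roots on the extremal basis `(0,1,4,5)`, engine-5 has `14`) — the sector is PROVABLY NOT FULL
           at `(3,4)` (given the gap rule) ·
  `(4,3)`: `16 ≤ η ≤ 20 = σ` (open: degree `10 = n(4,2)` on `(0,1,3)` with `det S₂ = 0`, or on `(0,1,4)` with `rank S₂ ≤ 2`).
READING (the bet the critics asked for, now located): the sector is NEVER full in the kernel currency (`η < M` at
every decided cell: `8/11, 16/19, 24/29`), but the slack is the PARITY/GAP slack of real-rootedness only —
`σ(m,K) = 2 n(m,K−1)` is of the same order `Θ_m(K^m)` as `M(m,K) = 2·C(m+K−1,m) − 1` for fixed `m`, and at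
`m = 2` sector-fullness «`η(2,K) = 2 n(2,K−1)`» (all extremal stamp bases realisable by `2×2` symmetric
half-pencils — crit-1's Lorentz-model bet made precise) would put `η(2,K)/M(2,K) → 2c` with `c = lim n(2,k)/k²`
an OPEN constant of additive number theory (`2/7 ≤ c ≤ 0.4802…`).  So H3 is «MDR re-clothed» up to a bounded
factor at census scale; its content stays at quasi-polynomial `m`, where the stamp ceiling does NOT protect it:
`n(m,K−1) ≥ (⌊m/(K−1)⌋+1)^{K−1} − 1` (digit bases `{1,t,…,t^{K−2}}`, `t−1` stamps per digit) is
`2^{(K−1)(log m − log K)} ≫ 2^{K log K}` for `m = 2^{(log K)^c}`, `c ≥ 2` — i.e. **in the all-even sub-sector,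
H3 is EQUIVALENT to a NON-REALISABILITY statement**: for `K ≥ K₀`, `m ≤ qp(K)`, no symmetric `m×m` half-pencil
on `K` exponents is full-positive-rooted of degree `> 2^{K⌊log K⌋/2}/2`, although postage-stamp combinatorics
allows degree `2^{Ω(K log² K)}` («assume the law fails ⇒ the super-polynomial family is a full-positive-rooted
symmetric half-pencil on a near-extremal stamp basis» — what VNP-hardness would need to forbid).
Nothing here bears on the crux `MatrixDescartes` or on `VP ≠ VNP`.  [folklore] throughout (IVT at rational
points, degree count, Descartes' rule, `X ↦ X²`).
-/

-- `Summit.ValiantsHypothesis.ValiantsHypothesis.…` repeats a component by the D-0017 layout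
-- (single-conjunct summit), which the `dupNamespace` linter flags; the name is mandated.
set_option linter.dupNamespace false
set_option linter.style.longFile 0

noncomputable section

namespace Summit.ValiantsHypothesis.ValiantsHypothesis.Theses.LacunarySymmetroid.FiniteLine

open Summit.ValiantsHypothesis.ValiantsHypothesis.Theorems.LacunarySymmetroidMatrixDescartes
  (RealRootLawAt)
open Summit.ValiantsHypothesis.ValiantsHypothesis.Theorems.LacunarySymmetroidMatrixDescartes.Census
  (le_card_roots_pencil_of_alternating not_realRootLawAt_of_witness)
open Summit.ValiantsHypothesis.ValiantsHypothesis.Theorems.LacunarySymmetroidMatrixDescartes.DegreeCeiling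
  (natDegree_det_pencil_le)
open Summit.ValiantsHypothesis.ValiantsHypothesis.Theorems.LacunarySymmetroidMatrixDescartes.StubDescartesCeiling
  (support_det_pencil_subset)
open scoped BigOperators Matrix
open Polynomial

/-! ## §0 The sector and the stamp row (defs copied verbatim from the g2 door; workfiles are not importable) -/

/-- The lacunary symmetric pencil `F_{d,S}(X) = Σ_l X^{d l} S_l` as a polynomial matrix (census currency). -/
abbrev pencil {m K : ℕ} (d : Fin K → ℕ) (S : Fin K → Matrix (Fin m) (Fin m) ℝ) :
    Matrix (Fin m) (Fin m) ℝ[X] :=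
  ∑ l, ((Polynomial.X : ℝ[X]) ^ d l) • (S l).map Polynomial.C

/-- **The sector** (verbatim from line «hyperbolic»): `natDegree p` distinct real roots. -/
def IsRealRootedSimple (p : ℝ[X]) : Prop := p.roots.toFinset.card = p.natDegree

/-- **Sector row** «`η(m,K) ≤ B`» (verbatim from line «hyperbolic»). -/
def HypRootLawAt (m K B : ℕ) : Prop :=
  ∀ (d : Fin K → ℕ) (S : Fin K → Matrix (Fin m) (Fin m) ℝ), (∀ l, (S l).IsSymm) →
    IsRealRootedSimple (pencil d S).det → (pencil d S).det.natDegree ≤ B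

/-- **Full positive-rootedness**: `natDegree p` distinct POSITIVE roots (so, for `p ≠ 0`, all roots real, positive
and simple; `p = 0` and constants qualify vacuously). -/
def IsFullPosRooted (p : ℝ[X]) : Prop := (p.roots.filter (0 < ·)).toFinset.card = p.natDegree

/-- **Stamp row** «`ν(m,K) ≤ B`»: every full-positive-rooted determinant of a symmetric `(m,K)` half-pencil has
degree `≤ B`. -/
def StampLawAt (m K B : ℕ) : Prop :=
  ∀ (d : Fin K → ℕ) (S : Fin K → Matrix (Fin m) (Fin m) ℝ), (∀ l, (S l).IsSymm) →
    IsFullPosRooted (pencil d S).det → (pencil d S).det.natDegree ≤ B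

/-! ## §1 T1 — a rational alternation certificate of full length puts a pencil IN the sector (PROVED) -/

/-- **T1.**  Exponents `≤ D` and `N + 1 = m·D + 1` strictly increasing reals along which `det (∑ l, t^(d l) S l)`
alternates in sign ⟹ `natDegree det = Z = m·D`.  By name: tree `DegreeCeiling.natDegree_det_pencil_le`
(`deg ≤ m·D`), tree `Census.le_card_roots_pencil_of_alternating` (`Z ≥ N`), Mathlib `card_roots'`. [folklore] -/
theorem natDegree_eq_and_card_eq_of_alternating {m K : ℕ} (d : Fin K → ℕ)
    (S : Fin K → Matrix (Fin m) (Fin m) ℝ) (D N : ℕ) (hN : N = m * D) (hD : ∀ l, d l ≤ D)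
    (τ : Fin (N + 1) → ℝ) (hτ : StrictMono τ)
    (halt : ∀ j : Fin N,
      (∑ l, τ j.castSucc ^ d l • S l).det * (∑ l, τ j.succ ^ d l • S l).det < 0) :
    (Matrix.det (∑ l, ((Polynomial.X : ℝ[X]) ^ d l) • (S l).map Polynomial.C)).natDegree = N ∧
    (Matrix.det (∑ l, ((Polynomial.X : ℝ[X]) ^ d l) • (S l).map Polynomial.C)).roots.toFinset.card = N := by
  have h1 : N ≤ (Matrix.det (∑ l, ((Polynomial.X : ℝ[X]) ^ d l) • (S l).map Polynomial.C)
      ).roots.toFinset.card := le_card_roots_pencil_of_alternating d S N τ hτ halt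
  have h2 : (Matrix.det (∑ l, ((Polynomial.X : ℝ[X]) ^ d l) • (S l).map Polynomial.C)).natDegree ≤ m * D :=
    natDegree_det_pencil_le d S D hD
  have h3 : (Matrix.det (∑ l, ((Polynomial.X : ℝ[X]) ^ d l) • (S l).map Polynomial.C)
      ).roots.toFinset.card ≤
      (Matrix.det (∑ l, ((Polynomial.X : ℝ[X]) ^ d l) • (S l).map Polynomial.C)).natDegree :=
    (Multiset.toFinset_card_le _).trans (Polynomial.card_roots' _)
  constructor <;> omega

/-- T1, sector form: the certified pencil is IN the sector. [folklore] -/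
theorem isRealRootedSimple_of_alternating {m K : ℕ} (d : Fin K → ℕ)
    (S : Fin K → Matrix (Fin m) (Fin m) ℝ) (D N : ℕ) (hN : N = m * D) (hD : ∀ l, d l ≤ D)
    (τ : Fin (N + 1) → ℝ) (hτ : StrictMono τ)
    (halt : ∀ j : Fin N,
      (∑ l, τ j.castSucc ^ d l • S l).det * (∑ l, τ j.succ ^ d l • S l).det < 0) :
    IsRealRootedSimple (pencil d S).det ∧ (pencil d S).det.natDegree = N := by
  obtain ⟨hdeg, hcard⟩ := natDegree_eq_and_card_eq_of_alternating d S D N hN hD τ hτ halt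
  exact ⟨hcard.trans hdeg.symm, hdeg⟩

/-- **T1 ⇒ the sector row is decided from below by one certificate**: `η(m,K) ≥ m·D`. [folklore] -/
theorem not_hypRootLawAt_of_alternating {m K B : ℕ} (d : Fin K → ℕ)
    (S : Fin K → Matrix (Fin m) (Fin m) ℝ) (hS : ∀ l, (S l).IsSymm) (D N : ℕ) (hN : N = m * D)
    (hD : ∀ l, d l ≤ D) (τ : Fin (N + 1) → ℝ) (hτ : StrictMono τ)
    (halt : ∀ j : Fin N,
      (∑ l, τ j.castSucc ^ d l • S l).det * (∑ l, τ j.succ ^ d l • S l).det < 0)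
    (hB : B < N) : ¬ HypRootLawAt m K B := fun h => by
  obtain ⟨hdeg, hcard⟩ := natDegree_eq_and_card_eq_of_alternating d S D N hN hD τ hτ halt
  have h1 : (Matrix.det (∑ l, ((Polynomial.X : ℝ[X]) ^ d l) • (S l).map Polynomial.C)).natDegree ≤ B :=
    h d S hS (hcard.trans hdeg.symm)
  omega

/-- The same certificate in the census currency (all real zeros): `M(m,K) ≥ N`. [folklore] -/
theorem not_realRootLawAt_of_alternating {m K B : ℕ} (d : Fin K → ℕ)
    (S : Fin K → Matrix (Fin m) (Fin m) ℝ) (hS : ∀ l, (S l).IsSymm) (N : ℕ)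
    (τ : Fin (N + 1) → ℝ) (hτ : StrictMono τ)
    (halt : ∀ j : Fin N,
      (∑ l, τ j.castSucc ^ d l • S l).det * (∑ l, τ j.succ ^ d l • S l).det < 0)
    (hB : B < N) : ¬ RealRootLawAt m K B :=
  not_realRootLawAt_of_witness d S hS (lt_of_lt_of_le hB (le_card_roots_pencil_of_alternating d S N τ hτ halt))

/-! ## §2 T2 — DOUBLING `X ↦ X²`: a full-positive-rooted half-pencil gives an in-sector pencil of twice the degree (PROVED) -/

/-- Doubling the exponents is applying `expand 2` entrywise. [folklore] -/
theorem pencil_double {m K : ℕ} (d : Fin K → ℕ) (S : Fin K → Matrix (Fin m) (Fin m) ℝ) :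
    (∑ l, ((Polynomial.X : ℝ[X]) ^ (2 * d l)) • (S l).map Polynomial.C)
      = (∑ l, ((Polynomial.X : ℝ[X]) ^ d l) • (S l).map Polynomial.C).map (Polynomial.expand ℝ 2) := by
  ext i j
  simp only [Matrix.map_apply, Matrix.sum_apply, Matrix.smul_apply, smul_eq_mul, map_sum, map_mul,
    map_pow, Polynomial.expand_X, Polynomial.expand_C, pow_mul]

/-- **`det F_{2d,S} = (det F_{d,S})(X²)`.** [folklore] -/
theorem det_pencil_double {m K : ℕ} (d : Fin K → ℕ) (S : Fin K → Matrix (Fin m) (Fin m) ℝ) :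
    (Matrix.det (∑ l, ((Polynomial.X : ℝ[X]) ^ (2 * d l)) • (S l).map Polynomial.C))
      = Polynomial.expand ℝ 2 (Matrix.det (∑ l, ((Polynomial.X : ℝ[X]) ^ d l) • (S l).map Polynomial.C)) := by
  rw [pencil_double, AlgHom.map_det]
  rfl

/-- `q(X²)` has at least twice as many distinct real roots as `q` has distinct positive roots (`±√r`). [folklore] -/
theorem two_mul_card_posRoots_le_card_roots_expand {q : ℝ[X]} (hq : q ≠ 0) :
    2 * (q.roots.filter (0 < ·)).toFinset.card ≤ (Polynomial.expand ℝ 2 q).roots.toFinset.card := by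
  set R := (q.roots.filter (0 < ·)).toFinset with hR
  have hq2 : Polynomial.expand ℝ 2 q ≠ 0 := (Polynomial.expand_ne_zero (by norm_num)).2 hq
  have hmemR : ∀ r ∈ R, 0 < r ∧ q.IsRoot r := by
    intro r hr
    rw [hR, Multiset.mem_toFinset, Multiset.mem_filter] at hr
    exact ⟨hr.2, (Polynomial.mem_roots hq).1 hr.1⟩
  have hroot : ∀ r ∈ R, ∀ x : ℝ, x ^ 2 = r → x ∈ (Polynomial.expand ℝ 2 q).roots.toFinset := by
    intro r hr x hx
    rw [Multiset.mem_toFinset, Polynomial.mem_roots hq2, Polynomial.IsRoot, Polynomial.expand_eval, hx]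
    exact (hmemR r hr).2
  have h1 : R.image Real.sqrt ⊆ (Polynomial.expand ℝ 2 q).roots.toFinset := by
    intro x hx
    obtain ⟨r, hr, rfl⟩ := Finset.mem_image.1 hx
    exact hroot r hr _ (Real.sq_sqrt (hmemR r hr).1.le)
  have h2 : R.image (fun r => -Real.sqrt r) ⊆ (Polynomial.expand ℝ 2 q).roots.toFinset := by
    intro x hx
    obtain ⟨r, hr, rfl⟩ := Finset.mem_image.1 hx
    exact hroot r hr _ (by rw [neg_sq]; exact Real.sq_sqrt (hmemR r hr).1.le)
  have hinj1 : Set.InjOn Real.sqrt R := fun a ha b hb h =>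
    (Real.sqrt_inj (hmemR a ha).1.le (hmemR b hb).1.le).1 h
  have hinj2 : Set.InjOn (fun r => -Real.sqrt r) R := fun a ha b hb h =>
    hinj1 ha hb (neg_injective h)
  have hdisj : Disjoint (R.image Real.sqrt) (R.image fun r => -Real.sqrt r) := by
    rw [Finset.disjoint_left]
    intro x hx1 hx2
    obtain ⟨a, ha, rfl⟩ := Finset.mem_image.1 hx1
    obtain ⟨b, hb, hab⟩ := Finset.mem_image.1 hx2
    have ha' : 0 < Real.sqrt a := Real.sqrt_pos.2 (hmemR a ha).1
    have hb' : 0 ≤ Real.sqrt b := Real.sqrt_nonneg b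
    have hab' : -Real.sqrt b = Real.sqrt a := hab
    linarith
  calc 2 * R.card = (R.image Real.sqrt).card + (R.image fun r => -Real.sqrt r).card := by
        rw [Finset.card_image_of_injOn hinj1, Finset.card_image_of_injOn hinj2]; ring
    _ = (R.image Real.sqrt ∪ R.image fun r => -Real.sqrt r).card :=
        (Finset.card_union_of_disjoint hdisj).symm
    _ ≤ _ := Finset.card_le_card (Finset.union_subset h1 h2)

/-- **T2 (polynomial form).**  `q` full-positive-rooted ⟹ `q(X²)` in the sector, of degree `2 · natDegree q`.
[folklore] -/
theorem isRealRootedSimple_expand_of_fullPos {q : ℝ[X]} (hfull : IsFullPosRooted q) :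
    IsRealRootedSimple (Polynomial.expand ℝ 2 q) ∧ (Polynomial.expand ℝ 2 q).natDegree = 2 * q.natDegree := by
  by_cases hq : q = 0
  · subst hq
    simp [IsRealRootedSimple]
  have hdeg : (Polynomial.expand ℝ 2 q).natDegree = 2 * q.natDegree := by
    rw [Polynomial.natDegree_expand, mul_comm]
  refine ⟨?_, hdeg⟩
  unfold IsRealRootedSimple
  refine le_antisymm ((Multiset.toFinset_card_le _).trans (Polynomial.card_roots' _)) ?_
  rw [hdeg]
  unfold IsFullPosRooted at hfull
  rw [← hfull]
  exact two_mul_card_posRoots_le_card_roots_expand hq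

/-- **T2.**  If `det F_{d,S}` is full-positive-rooted then `det F_{2d,S}` is in the sector, of twice the degree.
[folklore] -/
theorem isRealRootedSimple_double {m K : ℕ} (d : Fin K → ℕ) (S : Fin K → Matrix (Fin m) (Fin m) ℝ)
    (hfull : IsFullPosRooted (Matrix.det (∑ l, ((Polynomial.X : ℝ[X]) ^ d l) • (S l).map Polynomial.C))) :
    IsRealRootedSimple (Matrix.det (∑ l, ((Polynomial.X : ℝ[X]) ^ (2 * d l)) • (S l).map Polynomial.C)) ∧
    (Matrix.det (∑ l, ((Polynomial.X : ℝ[X]) ^ (2 * d l)) • (S l).map Polynomial.C)).natDegree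
      = 2 * (Matrix.det (∑ l, ((Polynomial.X : ℝ[X]) ^ d l) • (S l).map Polynomial.C)).natDegree := by
  rw [det_pencil_double]
  exact isRealRootedSimple_expand_of_fullPos hfull

/-- **`ν(m,K) ≥ n ⇒ η(m,K) ≥ 2n`**: a full-positive-rooted half-pencil of degree `n` refutes the sector row
`2n − 1` (doubled exponents, same symmetric coefficients). [folklore] -/
theorem not_hypRootLawAt_of_fullPos {m K B : ℕ} (d : Fin K → ℕ) (S : Fin K → Matrix (Fin m) (Fin m) ℝ)
    (hS : ∀ l, (S l).IsSymm)
    (hfull : IsFullPosRooted (Matrix.det (∑ l, ((Polynomial.X : ℝ[X]) ^ d l) • (S l).map Polynomial.C)))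
    (hB : B < 2 * (Matrix.det (∑ l, ((Polynomial.X : ℝ[X]) ^ d l) • (S l).map Polynomial.C)).natDegree) :
    ¬ HypRootLawAt m K B := fun h => by
  obtain ⟨hsec, hdeg⟩ := isRealRootedSimple_double d S hfull
  have h1 : (Matrix.det (∑ l, ((Polynomial.X : ℝ[X]) ^ (2 * d l)) • (S l).map Polynomial.C)).natDegree ≤ B :=
    h (fun l => 2 * d l) S hS hsec
  omega

/-- **Sector row ⇒ stamp row**: `η(m,K) ≤ 2B + 1 ⇒ ν(m,K) ≤ B`. [folklore] -/
theorem stampLawAt_of_hypRootLawAt {m K B : ℕ} (h : HypRootLawAt m K (2 * B + 1)) : StampLawAt m K B := by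
  intro d S hS hfull
  by_contra hlt
  have hlt' : B < (Matrix.det (∑ l, ((Polynomial.X : ℝ[X]) ^ d l) • (S l).map Polynomial.C)).natDegree :=
    not_le.1 hlt
  exact not_hypRootLawAt_of_fullPos d S hS hfull (by omega) h

/-! ## §3 T3 — the POSTAGE-STAMP CEILING: full positive-rootedness forces `[0, deg] ⊆ m`-fold sumset of the exponents (PROVED) -/

/-- Descartes: `natDegree q` distinct positive roots force all `natDegree q + 1` coefficients to be non-zero.
(Mathlib `roots_countP_pos_le_signVariations`, Literature `signVariations_lt_card_support`.) [folklore] -/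
theorem coeff_ne_zero_of_fullPos {q : ℝ[X]} (hq : q ≠ 0) (hfull : IsFullPosRooted q) {r : ℕ}
    (hr : r ≤ q.natDegree) : q.coeff r ≠ 0 := by
  have h1 : q.natDegree ≤ q.roots.countP (0 < ·) := by
    rw [Multiset.countP_eq_card_filter]
    unfold IsFullPosRooted at hfull
    calc q.natDegree = (q.roots.filter (0 < ·)).toFinset.card := hfull.symm
      _ ≤ _ := Multiset.toFinset_card_le _
  have h2 : q.roots.countP (0 < ·) ≤ q.signVariations := Polynomial.roots_countP_pos_le_signVariations q
  have h3 : q.signVariations < q.support.card :=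
    Literature.Computability.AlgebraicComplexity.signVariations_lt_card_support hq
  have h4 : q.support ⊆ Finset.range (q.natDegree + 1) := Polynomial.supp_subset_range_natDegree_succ
  have h5 : q.support = Finset.range (q.natDegree + 1) :=
    Finset.eq_of_subset_of_card_le h4 (by rw [Finset.card_range]; omega)
  rw [← Polynomial.mem_support_iff, h5, Finset.mem_range]
  omega

/-- **T3 (postage-stamp ceiling).**  If `det F_{d,S} ≠ 0` is full-positive-rooted of degree `n`, every
`r ≤ n` is a sum of `m` exponents `d l` (with repetition): `[0, n] ⊆ m·E`.  Hence `ν(m,K) ≤ n(m, K−1)`, the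
postage-stamp number (`m` stamps, `K − 1` denominations), and `η_even(m,K) = 2ν(m,K) ≤ 2 n(m,K−1)`.  (Tree
`StubDescartesCeiling.support_det_pencil_subset`.) [folklore] -/
theorem mem_sumset_of_fullPos {m K : ℕ} (d : Fin K → ℕ) (S : Fin K → Matrix (Fin m) (Fin m) ℝ)
    (hq : Matrix.det (∑ l, ((Polynomial.X : ℝ[X]) ^ d l) • (S l).map Polynomial.C) ≠ 0)
    (hfull : IsFullPosRooted (Matrix.det (∑ l, ((Polynomial.X : ℝ[X]) ^ d l) • (S l).map Polynomial.C)))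
    {r : ℕ}
    (hr : r ≤ (Matrix.det (∑ l, ((Polynomial.X : ℝ[X]) ^ d l) • (S l).map Polynomial.C)).natDegree) :
    r ∈ (Finset.univ : Finset (Sym (Fin K) m)).image
      (fun s : Sym (Fin K) m => ((s : Multiset (Fin K)).map d).sum) :=
  support_det_pencil_subset d S
    (Polynomial.mem_support_iff.2 (coeff_ne_zero_of_fullPos hq hfull hr))

/-! ## §4 KERNEL CERTIFICATES — the located sector rows (doubled engine-5 records, T1) -/

/-! ### Cell `(2,4)`: doubled engine-5 record `E5W1A-m2K4-d0-1-3-4-s0-n8-00` (half-support `(0, 1, 3, 4)`, full positive-rooted,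
degree `8`) ⇒ in-sector pencil on `(0, 2, 6, 8)` of degree `16` with `16` simple real roots: **`η(2,4) ≥ 16`**. -/

/-- Exponents of the doubled `(2,4)` record: `2·(0, 1, 3, 4)`. -/
def d24e : Fin 4 → ℕ := ![0, 2, 6, 8]

/-- Coefficients of the `(2,4)` record `E5W1A-m2K4-d0-1-3-4-s0-n8-00` (integer symmetric `2×2` blocks, engine-5, exact). -/
def S24e : Fin 4 → Matrix (Fin 2) (Fin 2) ℝ :=
  ![!![-283644, 329455; 329455, -380779],
    !![792372, -585144; -585144, 243711],
    !![-1000000, -463770; -463770, 34229],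
    !![454944, 407730; 407730, 362199]]

/-- The `17` dyadic certificate points (Sturm-isolating, exact; `instr/doubling_cert.py`). -/
noncomputable def τ24e : Fin 17 → ℝ :=
  ![-3, -5 / 2, -9 / 4, -2, -1, -1 / 2, -3 / 8, -11 / 32, 0, 11 / 32, 3 / 8, 1 / 2, 1, 2, 9 / 4, 5 / 2, 3]

theorem S24e_symm (l : Fin 4) : (S24e l).IsSymm := by
  fin_cases l <;> (unfold Matrix.IsSymm; ext i j; fin_cases i <;> fin_cases j <;> simp [S24e])

theorem τ24e_strictMono : StrictMono τ24e := by
  refine Fin.strictMono_iff_lt_succ.2 fun j => ?_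
  fin_cases j <;> simp [τ24e] <;> norm_num

/-- Sign alternation of `det (∑ l, t^(d l) S l)` along the `17` points (`norm_num`). [folklore] -/
theorem alt24e : ∀ j : Fin 16,
    (∑ l, τ24e j.castSucc ^ d24e l • S24e l).det * (∑ l, τ24e j.succ ^ d24e l • S24e l).det < 0 := by
  intro j
  fin_cases j <;> simp [d24e, S24e, τ24e, Matrix.det_fin_two, Fin.sum_univ_four] <;> norm_num

/-- **`deg = Z = 16`** for the doubled record: it lies IN the sector (T1 `natDegree_eq_and_card_eq_of_alternating`). -/
theorem natDegree_and_card_F24e :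
    (Matrix.det (∑ l, ((Polynomial.X : ℝ[X]) ^ d24e l) • (S24e l).map Polynomial.C)).natDegree = 16 ∧
    (Matrix.det (∑ l, ((Polynomial.X : ℝ[X]) ^ d24e l) • (S24e l).map Polynomial.C)).roots.toFinset.card = 16 :=
  natDegree_eq_and_card_eq_of_alternating d24e S24e 8 16 (by norm_num)
    (fun l => by fin_cases l <;> simp [d24e]) τ24e τ24e_strictMono alt24e

/-- **`¬ HypRootLawAt 2 4 15`, i.e. `η(2,4) ≥ 16`** (sector row; folded). -/
theorem not_hypRootLawAt_two_four_15 : ¬ HypRootLawAt 2 4 15 := fun h => by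
  obtain ⟨hdeg, hcard⟩ := natDegree_and_card_F24e
  have h1 := h d24e S24e S24e_symm (hcard.trans hdeg.symm)
  simp only [hdeg] at h1
  omega

/-- The same, UNFOLDED (citable without this workfile's definitions). -/
theorem not_hypRootLawAt_two_four_15' :
    ¬ (∀ (d : Fin 4 → ℕ) (S : Fin 4 → Matrix (Fin 2) (Fin 2) ℝ), (∀ l, (S l).IsSymm) →
        (Matrix.det (∑ l, ((Polynomial.X : Polynomial ℝ) ^ d l) • (S l).map Polynomial.C)
            ).roots.toFinset.card =
          (Matrix.det (∑ l, ((Polynomial.X : Polynomial ℝ) ^ d l) • (S l).map Polynomial.C)).natDegree →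
        (Matrix.det (∑ l, ((Polynomial.X : Polynomial ℝ) ^ d l) • (S l).map Polynomial.C)).natDegree
          ≤ 15) :=
  fun h => not_hypRootLawAt_two_four_15 h

/-! ### Cell `(2,5)`: doubled engine-5 record `E5W1A-m2K5-d0-1-3-5-6-s0-n12-00` (half-support `(0, 1, 3, 5, 6)`, full positive-rooted,
degree `12`) ⇒ in-sector pencil on `(0, 2, 6, 10, 12)` of degree `24` with `24` simple real roots: **`η(2,5) ≥ 24`**. -/

/-- Exponents of the doubled `(2,5)` record: `2·(0, 1, 3, 5, 6)`. -/
def d25e : Fin 5 → ℕ := ![0, 2, 6, 10, 12]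

/-- Coefficients of the `(2,5)` record `E5W1A-m2K5-d0-1-3-5-6-s0-n12-00` (integer symmetric `2×2` blocks, engine-5, exact). -/
def S25e : Fin 5 → Matrix (Fin 2) (Fin 2) ℝ :=
  ![!![-1738888955, -1716728495; -1716728495, -1694742636],
    !![-3134471826, -2793106713; -2793106713, -2463787240],
    !![-10000000000, -4964934771; -4964934771, -351267186],
    !![-4541076893, -758549163; -758549163, 56384759],
    !![-3245616647, 179074697; 179074697, -7648763]]

/-- The `25` dyadic certificate points (Sturm-isolating, exact; `instr/doubling_cert.py`). -/
noncomputable def τ25e : Fin 25 → ℝ :=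
  ![-4, -2, -3 / 2, -5 / 4, -9 / 8, -1, -3 / 4, -11 / 16, -5 / 8, -19 / 32, -1 / 2, -1 / 4, 0, 1 / 4, 1 / 2, 19 / 32, 5 / 8, 11 / 16, 3 / 4, 1, 9 / 8, 5 / 4, 3 / 2, 2, 4]

theorem S25e_symm (l : Fin 5) : (S25e l).IsSymm := by
  fin_cases l <;> (unfold Matrix.IsSymm; ext i j; fin_cases i <;> fin_cases j <;> simp [S25e])

theorem τ25e_strictMono : StrictMono τ25e := by
  refine Fin.strictMono_iff_lt_succ.2 fun j => ?_
  fin_cases j <;> simp [τ25e] <;> norm_num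

/-- Sign alternation of `det (∑ l, t^(d l) S l)` along the `25` points (`norm_num`). [folklore] -/
theorem alt25e : ∀ j : Fin 24,
    (∑ l, τ25e j.castSucc ^ d25e l • S25e l).det * (∑ l, τ25e j.succ ^ d25e l • S25e l).det < 0 := by
  intro j
  fin_cases j <;> simp [d25e, S25e, τ25e, Matrix.det_fin_two, Fin.sum_univ_five] <;> norm_num

/-- **`deg = Z = 24`** for the doubled record: it lies IN the sector (T1 `natDegree_eq_and_card_eq_of_alternating`). -/
theorem natDegree_and_card_F25e :
    (Matrix.det (∑ l, ((Polynomial.X : ℝ[X]) ^ d25e l) • (S25e l).map Polynomial.C)).natDegree = 24 ∧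
    (Matrix.det (∑ l, ((Polynomial.X : ℝ[X]) ^ d25e l) • (S25e l).map Polynomial.C)).roots.toFinset.card = 24 :=
  natDegree_eq_and_card_eq_of_alternating d25e S25e 12 24 (by norm_num)
    (fun l => by fin_cases l <;> simp [d25e]) τ25e τ25e_strictMono alt25e

/-- **`¬ HypRootLawAt 2 5 23`, i.e. `η(2,5) ≥ 24`** (sector row; folded). -/
theorem not_hypRootLawAt_two_five_23 : ¬ HypRootLawAt 2 5 23 := fun h => by
  obtain ⟨hdeg, hcard⟩ := natDegree_and_card_F25e
  have h1 := h d25e S25e S25e_symm (hcard.trans hdeg.symm)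
  simp only [hdeg] at h1
  omega

/-- The same, UNFOLDED (citable without this workfile's definitions). -/
theorem not_hypRootLawAt_two_five_23' :
    ¬ (∀ (d : Fin 5 → ℕ) (S : Fin 5 → Matrix (Fin 2) (Fin 2) ℝ), (∀ l, (S l).IsSymm) →
        (Matrix.det (∑ l, ((Polynomial.X : Polynomial ℝ) ^ d l) • (S l).map Polynomial.C)
            ).roots.toFinset.card =
          (Matrix.det (∑ l, ((Polynomial.X : Polynomial ℝ) ^ d l) • (S l).map Polynomial.C)).natDegree →
        (Matrix.det (∑ l, ((Polynomial.X : Polynomial ℝ) ^ d l) • (S l).map Polynomial.C)).natDegree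
          ≤ 23) :=
  fun h => not_hypRootLawAt_two_five_23 h

/-! ### Cell `(2,6)`: doubled engine-5 record `E5W1A-m2K6-d0-1-2-5-6-7-s0-n14-00` (half-support `(0, 1, 2, 5, 6, 7)`, full positive-rooted,
degree `14`) ⇒ in-sector pencil on `(0, 2, 4, 10, 12, 14)` of degree `28` with `28` simple real roots: **`η(2,6) ≥ 28`**. -/

/-- Exponents of the doubled `(2,6)` record: `2·(0, 1, 2, 5, 6, 7)`. -/
def d26e : Fin 6 → ℕ := ![0, 2, 4, 10, 12, 14]

/-- Coefficients of the `(2,6)` record `E5W1A-m2K6-d0-1-2-5-6-7-s0-n14-00` (integer symmetric `2×2` blocks, engine-5, exact). -/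
def S26e : Fin 6 → Matrix (Fin 2) (Fin 2) ℝ :=
  ![!![-9673964, 4695216; 4695216, -2278732],
    !![27925539, -24023837; -24023837, 16736112],
    !![-12762459, 21890459; 21890459, -29449671],
    !![15462181, 12388962; 12388962, -59171970],
    !![-51254579, 84933200; 84933200, -36800512],
    !![-100000000, 23256220; 23256220, -5406546]]

/-- The `29` dyadic certificate points (Sturm-isolating, exact; `instr/doubling_cert.py`). -/
noncomputable def τ26e : Fin 29 → ℝ :=
  ![-8, -2, -7 / 4, -3 / 2, -5 / 4, -7 / 8, -27 / 32, -13 / 16, -3 / 4, -11 / 16, -5 / 8, -1 / 2, -3 / 8, -1 / 4, 0, 1 / 4, 3 / 8, 1 / 2, 5 / 8, 11 / 16, 3 / 4, 13 / 16, 27 / 32, 7 / 8, 5 / 4, 3 / 2, 7 / 4, 2, 8]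

theorem S26e_symm (l : Fin 6) : (S26e l).IsSymm := by
  fin_cases l <;> (unfold Matrix.IsSymm; ext i j; fin_cases i <;> fin_cases j <;> simp [S26e])

theorem τ26e_strictMono : StrictMono τ26e := by
  refine Fin.strictMono_iff_lt_succ.2 fun j => ?_
  fin_cases j <;> simp [τ26e] <;> norm_num

/-- Sign alternation of `det (∑ l, t^(d l) S l)` along the `29` points (`norm_num`). [folklore] -/
theorem alt26e : ∀ j : Fin 28,
    (∑ l, τ26e j.castSucc ^ d26e l • S26e l).det * (∑ l, τ26e j.succ ^ d26e l • S26e l).det < 0 := by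
  intro j
  fin_cases j <;> simp [d26e, S26e, τ26e, Matrix.det_fin_two, Fin.sum_univ_six] <;> norm_num

/-- **`deg = Z = 28`** for the doubled record: it lies IN the sector (T1 `natDegree_eq_and_card_eq_of_alternating`). -/
theorem natDegree_and_card_F26e :
    (Matrix.det (∑ l, ((Polynomial.X : ℝ[X]) ^ d26e l) • (S26e l).map Polynomial.C)).natDegree = 28 ∧
    (Matrix.det (∑ l, ((Polynomial.X : ℝ[X]) ^ d26e l) • (S26e l).map Polynomial.C)).roots.toFinset.card = 28 :=
  natDegree_eq_and_card_eq_of_alternating d26e S26e 14 28 (by norm_num)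
    (fun l => by fin_cases l <;> simp [d26e]) τ26e τ26e_strictMono alt26e

/-- **`¬ HypRootLawAt 2 6 27`, i.e. `η(2,6) ≥ 28`** (sector row; folded). -/
theorem not_hypRootLawAt_two_six_27 : ¬ HypRootLawAt 2 6 27 := fun h => by
  obtain ⟨hdeg, hcard⟩ := natDegree_and_card_F26e
  have h1 := h d26e S26e S26e_symm (hcard.trans hdeg.symm)
  simp only [hdeg] at h1
  omega

/-- The same, UNFOLDED (citable without this workfile's definitions). -/
theorem not_hypRootLawAt_two_six_27' :
    ¬ (∀ (d : Fin 6 → ℕ) (S : Fin 6 → Matrix (Fin 2) (Fin 2) ℝ), (∀ l, (S l).IsSymm) →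
        (Matrix.det (∑ l, ((Polynomial.X : Polynomial ℝ) ^ d l) • (S l).map Polynomial.C)
            ).roots.toFinset.card =
          (Matrix.det (∑ l, ((Polynomial.X : Polynomial ℝ) ^ d l) • (S l).map Polynomial.C)).natDegree →
        (Matrix.det (∑ l, ((Polynomial.X : Polynomial ℝ) ^ d l) • (S l).map Polynomial.C)).natDegree
          ≤ 27) :=
  fun h => not_hypRootLawAt_two_six_27 h

/-! ### Cell `(3,4)`: doubled engine-5 record `E5W1A-m3K4-d0-1-3-4-s0-n12-00` (half-support `(0, 1, 3, 4)`, full positive-rooted,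
degree `12`) ⇒ in-sector pencil on `(0, 2, 6, 8)` of degree `24` with `24` simple real roots: **`η(3,4) ≥ 24`**. -/

/-- Exponents of the doubled `(3,4)` record: `2·(0, 1, 3, 4)`. -/
def d34e : Fin 4 → ℕ := ![0, 2, 6, 8]

/-- Coefficients of the `(3,4)` record `E5W1A-m3K4-d0-1-3-4-s0-n12-00` (integer symmetric `3×3` blocks, engine-5, exact). -/
def S34e : Fin 4 → Matrix (Fin 3) (Fin 3) ℝ :=
  ![!![-4312361, -3094916, -2712672; -3094916, -1144470, -1804157; -2712672, -1804157, -1688496],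
    !![9126053, -6996073, 1313870; -6996073, 6355557, -2859044; 1313870, -2859044, -1016659],
    !![-6539883, 4882058, 1720672; 4882058, 100000000, 18844907; 1720672, 18844907, 4013299],
    !![3283392, -8419437, -2635461; -8419437, 11119868, 5097504; -2635461, 5097504, 1812123]]

/-- The `25` dyadic certificate points (Sturm-isolating, exact; `instr/doubling_cert.py`). -/
noncomputable def τ34e : Fin 25 → ℝ :=
  ![-4, -3 / 2, -23 / 16, -5 / 4, -19 / 16, -1, -7 / 8, -3 / 4, -1 / 2, -7 / 16, -5 / 16, -9 / 32, 0, 9 / 32, 5 / 16, 7 / 16, 1 / 2, 3 / 4, 7 / 8, 1, 19 / 16, 5 / 4, 23 / 16, 3 / 2, 4]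

theorem S34e_symm (l : Fin 4) : (S34e l).IsSymm := by
  fin_cases l <;> (unfold Matrix.IsSymm; ext i j; fin_cases i <;> fin_cases j <;> simp [S34e])

theorem τ34e_strictMono : StrictMono τ34e := by
  refine Fin.strictMono_iff_lt_succ.2 fun j => ?_
  fin_cases j <;> simp [τ34e] <;> norm_num

/-- Sign alternation of `det (∑ l, t^(d l) S l)` along the `25` points (`norm_num`). [folklore] -/
theorem alt34e : ∀ j : Fin 24,
    (∑ l, τ34e j.castSucc ^ d34e l • S34e l).det * (∑ l, τ34e j.succ ^ d34e l • S34e l).det < 0 := by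
  intro j
  fin_cases j <;> simp [d34e, S34e, τ34e, Matrix.det_fin_three, Fin.sum_univ_four] <;> norm_num

/-- **`deg = Z = 24`** for the doubled record: it lies IN the sector (T1 `natDegree_eq_and_card_eq_of_alternating`). -/
theorem natDegree_and_card_F34e :
    (Matrix.det (∑ l, ((Polynomial.X : ℝ[X]) ^ d34e l) • (S34e l).map Polynomial.C)).natDegree = 24 ∧
    (Matrix.det (∑ l, ((Polynomial.X : ℝ[X]) ^ d34e l) • (S34e l).map Polynomial.C)).roots.toFinset.card = 24 :=
  natDegree_eq_and_card_eq_of_alternating d34e S34e 8 24 (by norm_num)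
    (fun l => by fin_cases l <;> simp [d34e]) τ34e τ34e_strictMono alt34e

/-- **`¬ HypRootLawAt 3 4 23`, i.e. `η(3,4) ≥ 24`** (sector row; folded). -/
theorem not_hypRootLawAt_three_four_23 : ¬ HypRootLawAt 3 4 23 := fun h => by
  obtain ⟨hdeg, hcard⟩ := natDegree_and_card_F34e
  have h1 := h d34e S34e S34e_symm (hcard.trans hdeg.symm)
  simp only [hdeg] at h1
  omega

/-- The same, UNFOLDED (citable without this workfile's definitions). -/
theorem not_hypRootLawAt_three_four_23' :
    ¬ (∀ (d : Fin 4 → ℕ) (S : Fin 4 → Matrix (Fin 3) (Fin 3) ℝ), (∀ l, (S l).IsSymm) →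
        (Matrix.det (∑ l, ((Polynomial.X : Polynomial ℝ) ^ d l) • (S l).map Polynomial.C)
            ).roots.toFinset.card =
          (Matrix.det (∑ l, ((Polynomial.X : Polynomial ℝ) ^ d l) • (S l).map Polynomial.C)).natDegree →
        (Matrix.det (∑ l, ((Polynomial.X : Polynomial ℝ) ^ d l) • (S l).map Polynomial.C)).natDegree
          ≤ 23) :=
  fun h => not_hypRootLawAt_three_four_23 h

/-! ## §5 The GAP RULE in the sector (PROVED by Rolle induction) and the SIEVE -/

/-- In the sector the root multiset is the full, duplicate-free list of `natDegree p` reals. [folklore] -/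
theorem card_roots_of_sector {p : ℝ[X]} (h : IsRealRootedSimple p) :
    Multiset.card p.roots = p.natDegree ∧ p.roots.Nodup := by
  have h1 : p.roots.toFinset.card ≤ Multiset.card p.roots := Multiset.toFinset_card_le _
  have h2 : Multiset.card p.roots ≤ p.natDegree := Polynomial.card_roots' p
  unfold IsRealRootedSimple at h
  refine ⟨by omega, ?_⟩
  rw [← Multiset.toFinset_card_eq_card_iff_nodup]
  omega

/-- **The sector is closed under differentiation** (Rolle: Mathlib `card_roots_toFinset_le_derivative`), and the
derivative drops the degree by exactly one. [folklore] -/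
theorem sector_derivative {p : ℝ[X]} (h : IsRealRootedSimple p) :
    IsRealRootedSimple (derivative p) ∧ (derivative p).natDegree = p.natDegree - 1 := by
  unfold IsRealRootedSimple at *
  have h1 := Polynomial.card_roots_toFinset_le_derivative p
  have h2 : (derivative p).roots.toFinset.card ≤ (derivative p).natDegree :=
    (Multiset.toFinset_card_le _).trans (Polynomial.card_roots' _)
  have h3 : (derivative p).natDegree ≤ p.natDegree - 1 := Polynomial.natDegree_derivative_le p
  constructor <;> omega

/-- **GAP RULE** (classical — a polynomial with only real zeros has no two consecutive vanishing coefficients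
between its extreme ones; Pólya–Szegő, *Problems and Theorems in Analysis* II, Part V; here in the sector, where
the zeros are moreover simple and a zero at the origin is at most simple): for every `r` with `r + 2 ≤ deg p`,
one of `a_r, a_{r+1}` is non-zero.  Proof: `r = 0` — `a₀ = a₁ = 0` makes `0` a double root; `r + 1` — pass to
`p'` (in the sector by `sector_derivative`) and use `a'_r = (r+1) a_{r+1}`. [folklore] -/
theorem gapRule : ∀ (r : ℕ) (p : ℝ[X]), p ≠ 0 → IsRealRootedSimple p → r + 2 ≤ p.natDegree →
    p.coeff r ≠ 0 ∨ p.coeff (r + 1) ≠ 0 := by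
  intro r
  induction r with
  | zero =>
    intro p hp hsec hdeg
    by_contra h
    obtain ⟨h0, h1⟩ := not_or.1 h
    have h0 : p.coeff 0 = 0 := not_not.1 h0
    have h1 : p.coeff (0 + 1) = 0 := not_not.1 h1
    have hdvd : (X - C (0 : ℝ)) ^ 2 ∣ p := by
      rw [map_zero, sub_zero, Polynomial.X_pow_dvd_iff]
      intro d hd
      interval_cases d <;> assumption
    have hmult : 2 ≤ p.rootMultiplicity 0 := (Polynomial.le_rootMultiplicity_iff hp).2 hdvd
    have hnodup := (card_roots_of_sector hsec).2
    have hcount := Multiset.nodup_iff_count_le_one.1 hnodup 0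
    rw [Polynomial.count_roots] at hcount
    omega
  | succ r ih =>
    intro p hp hsec hdeg
    have hp' : derivative p ≠ 0 := by
      intro h0
      have := Polynomial.derivative_eq_zero.1 h0
      omega
    obtain ⟨hsec', hdeg'⟩ := sector_derivative hsec
    have hr : r + 2 ≤ (derivative p).natDegree := by omega
    rcases ih (derivative p) hp' hsec' hr with h | h
    · left
      rw [Polynomial.coeff_derivative] at h
      exact left_ne_zero_of_mul h
    · right
      rw [Polynomial.coeff_derivative] at h
      exact left_ne_zero_of_mul h

/-- The gap rule as one proposition (kept as a `def` so the sieve below can be quoted with it as a named input). -/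
def GapRule : Prop := ∀ (r : ℕ) (p : ℝ[X]), p ≠ 0 → IsRealRootedSimple p → r + 2 ≤ p.natDegree →
  p.coeff r ≠ 0 ∨ p.coeff (r + 1) ≠ 0

theorem gapRule_holds : GapRule := gapRule

/-- **SIEVE.**  In the sector, of any two consecutive exponents below the degree at least one is an `m`-fold sum of
the pencil's exponents (gap rule + tree `support_det_pencil_subset`); together with `natDegree ∈ m·E`
(`natDegree_mem_sumset`) this makes `supp det` a chain with steps `≤ 2` from `{0,1}` to `natDegree` inside `m·E`,
whence the computed caps `η(m,K) ≤ σ(m,K)` of the header (finite enumeration, `instr/stamp.py`). [folklore] -/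
theorem sieve {m K : ℕ} (d : Fin K → ℕ) (S : Fin K → Matrix (Fin m) (Fin m) ℝ)
    (hq : Matrix.det (∑ l, ((Polynomial.X : ℝ[X]) ^ d l) • (S l).map Polynomial.C) ≠ 0)
    (hsec : IsRealRootedSimple (Matrix.det (∑ l, ((Polynomial.X : ℝ[X]) ^ d l) • (S l).map Polynomial.C)))
    {r : ℕ}
    (hr : r + 2 ≤ (Matrix.det (∑ l, ((Polynomial.X : ℝ[X]) ^ d l) • (S l).map Polynomial.C)).natDegree) :
    r ∈ (Finset.univ : Finset (Sym (Fin K) m)).image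
        (fun s : Sym (Fin K) m => ((s : Multiset (Fin K)).map d).sum) ∨
      r + 1 ∈ (Finset.univ : Finset (Sym (Fin K) m)).image
        (fun s : Sym (Fin K) m => ((s : Multiset (Fin K)).map d).sum) := by
  rcases gapRule r _ hq hsec hr with h | h
  · exact Or.inl (support_det_pencil_subset d S (Polynomial.mem_support_iff.2 h))
  · exact Or.inr (support_det_pencil_subset d S (Polynomial.mem_support_iff.2 h))

/-- The top of the chain: `natDegree det ∈ m·E` for a non-zero determinant. [folklore] -/
theorem natDegree_mem_sumset {m K : ℕ} (d : Fin K → ℕ) (S : Fin K → Matrix (Fin m) (Fin m) ℝ)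
    (hq : Matrix.det (∑ l, ((Polynomial.X : ℝ[X]) ^ d l) • (S l).map Polynomial.C) ≠ 0) :
    (Matrix.det (∑ l, ((Polynomial.X : ℝ[X]) ^ d l) • (S l).map Polynomial.C)).natDegree ∈
      (Finset.univ : Finset (Sym (Fin K) m)).image
        (fun s : Sym (Fin K) m => ((s : Multiset (Fin K)).map d).sum) :=
  support_det_pencil_subset d S (Polynomial.natDegree_mem_support_of_nonzero hq)

/-! ## §6 H3 read through the dictionary: in the all-even sub-sector H3 is a NON-REALISABILITY statement (PROVED glue) -/

/-- H3 of the door «hyperbolic», verbatim. -/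
def HyperbolicLaw : Prop :=
  ∀ c : ℕ, ∃ K₀ : ℕ, ∀ K m : ℕ, K₀ ≤ K → m ≤ 2 ^ ((Nat.log 2 K + c) ^ c) →
    ∀ (d : Fin K → ℕ) (S : Fin K → Matrix (Fin m) (Fin m) ℝ), (∀ l, (S l).IsSymm) →
      IsRealRootedSimple (pencil d S).det → (pencil d S).det.natDegree ^ 2 ≤ 2 ^ (K * Nat.log 2 K)

/-- **Stamp non-realisability at quasi-polynomial size** — what H3 says about full-positive-rooted half-pencils:
`(2·deg q)² ≤ 2^{K⌊log₂K⌋}` for every full-positive-rooted symmetric `(m,K)` half-pencil determinant `q`,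
`K ≥ K₀(c)`, `m ≤ 2^{(log K + c)^c}` — although the postage-stamp ceiling alone allows `deg q` as large as
`n(m,K−1) ≥ (⌊m/(K−1)⌋+1)^{K−1} − 1 = 2^{Ω(K log² K)}` there.  «Assume the law fails» ⇒ the violating family is
(after `X ↦ X²`) a full-positive-rooted symmetric half-pencil of super-polynomial degree on a near-extremal stamp
basis. -/
def StampNonRealisability : Prop :=
  ∀ c : ℕ, ∃ K₀ : ℕ, ∀ K m : ℕ, K₀ ≤ K → m ≤ 2 ^ ((Nat.log 2 K + c) ^ c) →
    ∀ (d : Fin K → ℕ) (S : Fin K → Matrix (Fin m) (Fin m) ℝ), (∀ l, (S l).IsSymm) →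
      IsFullPosRooted (pencil d S).det → (2 * (pencil d S).det.natDegree) ^ 2 ≤ 2 ^ (K * Nat.log 2 K)

/-- **H3 ⇒ stamp non-realisability** (doubling, T2). [folklore] -/
theorem stampNonRealisability_of_hyperbolicLaw (h : HyperbolicLaw) : StampNonRealisability := by
  intro c
  obtain ⟨K₀, hK₀⟩ := h c
  refine ⟨K₀, fun K m hK hm d S hS hfull => ?_⟩
  obtain ⟨hsec, hdeg⟩ := isRealRootedSimple_double d S hfull
  have h1 : (Matrix.det (∑ l, ((Polynomial.X : ℝ[X]) ^ (2 * d l)) • (S l).map Polynomial.C)).natDegree ^ 2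
      ≤ 2 ^ (K * Nat.log 2 K) := hK₀ K m hK hm (fun l => 2 * d l) S hS hsec
  rw [hdeg] at h1
  exact h1

/-! ## §7 COMPUTATION SECOND — the finite search spec, typed (targets for the desk's engines; existential stubs) -/

/-- **F4 — decides `η(3,3) ∈ {12, 14}`.**  A full-positive-rooted symmetric `3×3` half-pencil on the extremal stamp
basis `(0,1,3)` of degree `7 = n(3,2)` (forces `det S₂ = 0`; engine-5's best on this support is `8` positive zeros at
degree `9`, NOT full).  If it exists, doubling gives `η(3,3) = 14 = σ(3,3)`; if `ν(3,3) = 6`, then `η(3,3) = 12`. -/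
theorem stub_F4_three_three :
    ∃ S : Fin 3 → Matrix (Fin 3) (Fin 3) ℝ, (∀ l, (S l).IsSymm) ∧
      IsFullPosRooted (pencil (![0, 1, 3] : Fin 3 → ℕ) S).det ∧
      (pencil (![0, 1, 3] : Fin 3 → ℕ) S).det.natDegree = 7 := by
  -- LANDED by val-sym-eng-3 g4 (p605516 `…FiniteSectorRealisable`, `FiniteSector.fullyRealisable_three_013_seven :
  -- FullyRealisable 3 ![0,1,3] 7`): by-name citation, δ-unfold of `FullyRealisable`/`IsFullPosRooted`/`pencil`
  -- (stub-credit wiring val-port-1 g1, val-lit RULING #246 (a)).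
  exact Summit.ValiantsHypothesis.ValiantsHypothesis.Theorems.LacunarySymmetroidMatrixDescartes.FiniteSector.fullyRealisable_three_013_seven

/-- **F6 — decides `η(3,4) = 30`.**  `15 = n(3,3)` distinct positive zeros at degree `15` on the extremal basis
`(0,1,4,5)` (engine-5: `14`); doubling would give `η(3,4) = 30 = σ(3,4)` (still `< 34 = M_loc < 37 ≤ M`). -/
theorem stub_F6_three_four :
    ∃ S : Fin 4 → Matrix (Fin 3) (Fin 3) ℝ, (∀ l, (S l).IsSymm) ∧
      IsFullPosRooted (pencil (![0, 1, 4, 5] : Fin 4 → ℕ) S).det ∧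
      (pencil (![0, 1, 4, 5] : Fin 4 → ℕ) S).det.natDegree = 15 := by
  -- LANDED by val-sym-eng-3 g4 (p610527 `…FiniteSectorRealisableThreeFour`, `FiniteSector.fullyRealisable_three_0145_fifteen :
  -- FullyRealisable 3 ![0,1,4,5] 15` — F6, the line's hardest search target, REALISED): by-name citation, δ-unfold
  -- (stub-credit wiring val-port-1 g1, val-lit RULING #251 (b)).
  exact Summit.ValiantsHypothesis.ValiantsHypothesis.Theorems.LacunarySymmetroidMatrixDescartes.FiniteSector.fullyRealisable_three_0145_fifteen

/-- **F7 — decides `η(2,6) = 32`.**  `16 = n(2,5)` distinct positive zeros at degree `16` on the UNIQUE extremal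
basis `(0,1,3,5,7,8)` for `2×2` symmetric half-pencils (crit-1's Lorentz model predicts realisable; engine-5 has
full `14` on `(0,1,2,5,6,7)` and `(0,1,2,4,6,7)`, whence `η(2,6) ≥ 28` below). -/
theorem stub_F7_two_six :
    ∃ S : Fin 6 → Matrix (Fin 2) (Fin 2) ℝ, (∀ l, (S l).IsSymm) ∧
      IsFullPosRooted (pencil (![0, 1, 3, 5, 7, 8] : Fin 6 → ℕ) S).det ∧
      (pencil (![0, 1, 3, 5, 7, 8] : Fin 6 → ℕ) S).det.natDegree = 16 := by
  sorry

/-- **F5 — decides `η(4,3) = 20`.**  Degree `10 = n(4,2)` full-positive-rooted `4×4` on `(0,1,3)` (`det S₂ = 0`) —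
the twin basis `(0,1,4)` needs `rank S₂ ≤ 2`. -/
theorem stub_F5_four_three :
    ∃ S : Fin 3 → Matrix (Fin 4) (Fin 4) ℝ, (∀ l, (S l).IsSymm) ∧
      IsFullPosRooted (pencil (![0, 1, 3] : Fin 3 → ℕ) S).det ∧
      (pencil (![0, 1, 3] : Fin 3 → ℕ) S).det.natDegree = 10 := by
  -- LANDED by val-sym-eng-3 g4 (p605516 `…FiniteSectorRealisable`, `FiniteSector.fullyRealisable_four_013_ten :
  -- FullyRealisable 4 ![0,1,3] 10`): by-name citation, δ-unfold (stub-credit wiring val-port-1 g1, RULING #246 (a)).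
  exact Summit.ValiantsHypothesis.ValiantsHypothesis.Theorems.LacunarySymmetroidMatrixDescartes.FiniteSector.fullyRealisable_four_013_ten

end Summit.ValiantsHypothesis.ValiantsHypothesis.Theses.LacunarySymmetroid.FiniteLine

end
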